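import Summits.QuantumFields.BalabanUV.Beta.GAN24.ExchangeSlotResum
import Summits.QuantumFields.BalabanUV.Beta.GAN24.EEWordValue
import Summits.QuantumFields.BalabanUV.Beta.GAN24.DressedWilsonHalfVertexAnyAxis
import Summits.QuantumFields.BalabanUV.Beta.GAN24.LayerCommutatorAntisymm

/-!
# `BalabanUV.Beta.GAN24.VHWordsZeroLattice` — binder row G-an2-4 ∕ (CONV-C), W-slot CT-W, conservation law (C)∕(C)sym, step (L3) of this lineage's note
# `HOME/b2b-balaban-gan24-formalise-leaf-04/g65/CSYM-LEVEL0-KERNEL-BLUEPRINT.md` §6 («VH words: located open»): **A TWO-FACE WORD OF THE DRESSED LEVEL-0 SOURCE WHOSE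
# CELL-BOND SLOT IS SOURCED BY A TABLE WITH NO FIELD–FIELD BLOCK (the `S^VH = cVH • vhSAt` border sector) AND WHOSE LATTICE-BOND SLOT IS THE WILSON HALF-VERTEX VANISHES,
# bond by bond** — the `S^VH ⊗ S^E` direct word: resumming the Wilson slot leaves the exit-face CURRENT `t_R` on field legs only (`ExchangeSlotResum.hasSum_slot_word`,
# `ExchangeFieldLegs`); a left vertex with no ff block feeds it only through the MULTIPLIER rows of `X̃♮_0`, and those rows kill a current (fact (d1) «Φ = 0»:
# `DressedKernelOnFaceCurrent.tsum_dressedStep_zero_inr_mul_halfVertex_snd`)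

NOT IN PRINT; OUR BOOKKEEPING ([folklore] Fubini bookkeeping BY NAME over this lineage's GAN24 files 14 ∕ 16 ∕ 18 ∕ 19 ∕ 22, an2's kernel calculus, an5's `TameKernelCalculus`,
an2∕leaf-02's `BorderedHessianSymmetry ∕ BubbleParity ∕ LayerCommutatorAntisymm` (`sgnK`, `trK X̃ = sgnK X̃`); G-an2-4 formalisation swarm, leaf
prover `b2b-balaban-gan24-formalise-leaf-04`, gen 66).  HONEST FRAMING (cell contract, verbatim): «discharging `BetaPertH` makes Bałaban's UV stability UNCONDITIONAL — a real
constructive-QFT result; it is NOT the continuum limit and NOT the Clay problem.»  HONEST DEPENDENCY (verbatim): «continuum YM on T⁴ ⇐ BetaPertH ∧ nine spine estimates (0/9 proved);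
BetaPertH ⇐ (D1) ∧ (D4) ∧ CAP+tail; G-an2-4 gates asym, D1 and NE2/3/4.»

WHAT ([folklore]; generic `d`, in-block root `ρ = toSite r`, `1 ≤ Lc`, LEVEL `j = 0`, all units; ANY local stencil family `S′` with ZERO ff block (`cVH • vhSAt ρ`, `mfNeg (vhSAt ρ)`, …),
any axes `(μ, ν, α, β)`, any cell bond `c`; 0 `def`, 0 cited facts, 0 `def … : Prop`, 0 sorry): §1 `vertexOfK_unitS_noFF_inl_inl` (the chain-rule vertex over `S′` has no ff block);
§2 `exists_decay_data_left`, `comp_noFF_inl_inl`, **`tsum_noFF_left_wilson_right_word_eq_zero_of`** — for ANY left factor `P` bi-localised at one point with no ff block and ANY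
decaying middle kernel `Y` whose multiplier rows kill the resummed Wilson current (`hkill`, needed for `ν ≠ β` only): `Σ'_{u′} FF[(P ∘ Y) ∘ V^E_{ν,u′}] = 0`; §3 the two instances —
`unitS_wilsonA_antisymm`, **`tsum_noFF_left_wilson_right_word_eq_zero`** (DIRECT word, `P = vertexOfK X̃♮_0 Lc (unitS s_f s_m S′) μ c`, `Y = X̃♮_0`:
`Σ'_{u′} Σ'_{(y,w)} 𝟙f(y_α)𝟙f(w_β)·((V′_{μ,c} ∘ X̃♮_0) ∘ V^E_{ν,u′}) y w (inl α)(inl β) = 0`), **`tsum_wilson_left_noFF_right_word_eq_zero`** (SWAP word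
`Σ'_{u′} FF[(V^E_{ν,u′} ∘ X̃♮_0) ∘ V′_{μ,c}] = 0`, by transposition: `trK` reverses the word, `trK X̃♮_0 = sgnK X̃♮_0` (`LayerCommutatorAntisymm.trK_unitK_coDress`), `trK V^E = −V^E`
(`BubbleParity.trK_vertexOfK_of_antisymm`), and §2 applies with `Y = sgnK X̃♮_0`), `sum_box_noFF_wilson_words_eq_zero` (both cell-and-lattice sums of
`DressedSourceZeroModeWords.zmode_dressedSource_inl_inl` vanish).  The words with the `S′` slot on the LATTICE bond (`V^E_{μ,c} ⊗ V′_{ν,u′}` and its swap) and the `S′ ⊗ S′` words are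
NOT treated here.  Asserts NO value of Bałaban's tables beyond an3's DEFINED stencil and an1's DEFINED border table; discharges NOTHING of (C)sym ∕ (Q-D) ∕ (Q-D-rate) ∕ «T2Shape» ∕
«T2Drift» ∕ (hW, hWall); NEVER «G-an2-4 closed» as (CONV-C); NOT D1, NOT `BetaPertH`, NOT continuum, NOT Clay.  2026-08-23; no existing file touched.
-/

noncomputable section

open Finset
open scoped BigOperators
open Literature.MathematicalPhysics.QuantumFieldTheory
open Literature.MathematicalPhysics.QuantumFieldTheory.Balaban1983to89
open Literature.MathematicalPhysics.QuantumFieldTheory.Balaban1983to89.Beta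
open B12Sec2to5 (l1 l1_nonneg)
open ExpKernelCalculus (Site MKer comp Decays BiLoc VertexFamily)
open OneStepResolventKernel (Fib LocStencil wsum decays_mono biLoc_mono)
open BalabanStepJetsSucc (biLoc_comp_right)
open OneStepKernelFamily (KInvStep vertexOfK vertexFamily_vertexOfK decays_KInvStep)
open StepJetData (wilsonA locStencil_wilsonA locStencil_smul)
open AffineAveraging (Form2 box toSite curvAdj)
open PeriodicDescent (IsPeriodic)
open Summit.QuantumFields.BalabanUV.Beta.AxialDressingRooted (coDressKBmAt decays_coDressKBmAt)
open Summit.QuantumFields.BalabanUV.Beta.HessKerDressedUnits (unitK unitS unitS_apply decays_unitK locStencil_unitS)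
open Summit.QuantumFields.BalabanUV.Beta.GAN24.PeriodicForceMultiplier (bounded_of_periodic)
open Summit.QuantumFields.BalabanUV.Beta.GAN24.DressedWilsonHalfVertex (hasSum_faceHalfVertex_snd)
open Summit.QuantumFields.BalabanUV.Beta.GAN24.DressedKernelOnFaceCurrent (smul_curvAdj_periodic facePlaq_periodic tsum_dressedStep_zero_inr_mul_halfVertex_snd)
open Summit.QuantumFields.BalabanUV.Beta.GAN24.ExchangeFieldLegs (vertexOfK_wilson_inr_inl tsum_prod_faceHalfVertex)
open Summit.QuantumFields.BalabanUV.Beta.GAN24.EEWordValue (fubini3)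
open Summit.QuantumFields.BalabanUV.Beta.TameKernelCalculus (trK trK_apply trK_comp biLoc_trK Loc Spr Tame comp_assoc_tame comp_neg_right)
open Summit.QuantumFields.BalabanUV.Beta.BorderedHessian (sgnK sgnK_apply sgnF_inl sgnF_inr decays_sgnK)
open Summit.QuantumFields.BalabanUV.Beta.BubbleParity (vertexOfK_apply_eq_zero trK_vertexOfK_of_antisymm)
open Summit.QuantumFields.BalabanUV.Beta.GAN24.LayerCommutatorAntisymm (trK_unitK_coDress)
open Summit.QuantumFields.BalabanUV.Beta.GAN24.ExchangeSlotResum (hasSum_slot_word tsum_twoFace_eq_trK)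
open Summit.QuantumFields.BalabanUV.Beta.GAN24.DressedWilsonHalfVertexAnyAxis (tsum_faceHalfVertex_snd_diag)

namespace Summit.QuantumFields.BalabanUV.Beta.GAN24.VHWordsZeroLattice

variable {d : ℕ}

/-! ## §1 A chain-rule vertex over a table with no ff block has no ff block -/

/-- [folklore] If the stencil family `S′` has zero field–field block, so has `unitS s_f s_m S′`, hence (leaf-02's `BubbleParity.vertexOfK_apply_eq_zero`) so has the chain-rule vertex
`vertexOfK X N (unitS s_f s_m S′) κ u` over ANY kernel `X`. -/
theorem vertexOfK_unitS_noFF_inl_inl (X : MKer (d + 1) (Fib d)) (N : ℕ) (sf sm : ℝ) {S' : Fin (d + 1) → Site (d + 1) → MKer (d + 1) (Fib d)}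
    (hSff : ∀ (κ' : Fin (d + 1)) (t x z : Site (d + 1)) (α' a : Fin (d + 1)), S' κ' t x z (Sum.inl α') (Sum.inl a) = 0)
    (κ : Fin (d + 1)) (u y z : Site (d + 1)) (α' a : Fin (d + 1)) :
    vertexOfK X N (unitS sf sm S') κ u y z (Sum.inl α') (Sum.inl a) = 0 :=
  vertexOfK_apply_eq_zero (K := X) (N := N) (S := unitS sf sm S') (a := Sum.inl α') (b := Sum.inl a)
    (fun κ' t x' z' => by simp only [unitS_apply, hSff, mul_zero, zero_mul]) κ u y z

/-! ## §2 A left factor with no ff block, any decaying middle kernel whose multiplier rows kill the current, the Wilson slot on the lattice bond: zero -/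

section Word

variable {Lc : ℕ} [NeZero Lc] {r : Fin (d + 1) → ℕ} {μ ν α β : Fin (d + 1)}

/-- [folklore] **COMMON-RATE DECAY DATA AT LEVEL 0**: for a left factor `P` bi-localised at `(p, p)` and a decaying middle kernel `Y`, one rate `δ > 0` with `Y` decaying at `δ`, the
Wilson chain-rule vertex over `X̃♮_0` a vertex family at `δ`, and `P ∘ Y` bi-localised at `(p, p)` at `δ` (`vertexFamily_vertexOfK`, `biLoc_comp_right`). -/
theorem exists_decay_data_left (hLc : 1 ≤ Lc) (hr : r ∈ box (d + 1) Lc) (sf sm cE : ℝ) {P Y : MKer (d + 1) (Fib d)} {p : Site (d + 1)} {CP δP CY δY : ℝ}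
    (hP : BiLoc P p p CP δP) (hδP : 0 < δP) (hY : Decays Y CY δY) (hδY : 0 < δY) :
    ∃ δ CY' Cv CA : ℝ, 0 < δ ∧ 0 ≤ CY' ∧ 0 ≤ Cv ∧ 0 ≤ CA ∧ Decays Y CY' δ ∧
      VertexFamily (vertexOfK (unitK sf sm (coDressKBmAt (toSite r) Lc (KInvStep (d := d) Lc 0))) Lc (unitS sf sm (fun κ v => cE • wilsonA d κ v))) Lc Cv δ ∧
      BiLoc (comp P Y) p p CA δ ∧ BiLoc P p p CP δ := by
  obtain ⟨δK, CK, hδK, hCK, hXd⟩ := decays_coDressKBmAt hLc hr (decays_KInvStep (d := d) (Lc := Lc) 0)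
  have hXu := decays_unitK (sf := sf) (sm := sm) hXd
  have hCX : 0 ≤ max |sf| |sm| * CK * max |sf| |sm| := by positivity
  have hCP : 0 ≤ CP := hP.nonneg (Sum.inl 0)
  have hCY : 0 ≤ CY := hY.nonneg (Sum.inl 0)
  set δ₁ : ℝ := min δK (min δP δY) with hδ₁
  have hδ₁0 : 0 < δ₁ := lt_min hδK (lt_min hδP hδY)
  have h1K : δ₁ ≤ δK := min_le_left _ _
  have h1P : δ₁ ≤ δP := (min_le_right _ _).trans (min_le_left _ _)
  have h1Y : δ₁ ≤ δY := (min_le_right _ _).trans (min_le_right _ _)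
  have hX1 : Decays (unitK sf sm (coDressKBmAt (toSite r) Lc (KInvStep (d := d) Lc 0))) (max |sf| |sm| * CK * max |sf| |sm|) δ₁ := decays_mono hXu hCX le_rfl h1K
  have hSE := locStencil_unitS (sf := sf) (sm := sm) (locStencil_smul cE (locStencil_wilsonA (d := d) hδ₁0.le))
  obtain ⟨Cv, hVE⟩ : ∃ Cv : ℝ, VertexFamily (vertexOfK (unitK sf sm (coDressKBmAt (toSite r) Lc (KInvStep (d := d) Lc 0))) Lc (unitS sf sm (fun κ v => cE • wilsonA d κ v))) Lc Cv (δ₁ / 2) :=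
    ⟨_, vertexFamily_vertexOfK (N := Lc) hX1 hCX hSE hδ₁0 le_rfl⟩
  have hCv : 0 ≤ Cv := (hVE 0 0).nonneg (Sum.inl 0)
  have hP1 : BiLoc P p p CP (δ₁ / 2) := biLoc_mono hP hCP (by linarith)
  have hY1 : Decays Y CY (δ₁ / 2) := decays_mono hY hCY le_rfl (by linarith)
  obtain ⟨CA, hA⟩ : ∃ CA : ℝ, BiLoc (comp P Y) p p CA (δ₁ / 4) := ⟨_, biLoc_comp_right hP1 hY1 (by positivity) (by linarith)⟩
  have hCA : 0 ≤ CA := hA.nonneg (Sum.inl 0)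
  exact ⟨δ₁ / 4, CY, Cv, CA, by positivity, hCY, hCv, hCA, decays_mono hY hCY le_rfl (by linarith), fun κ v => biLoc_mono (hVE κ v) hCv (by linarith), hA,
    biLoc_mono hP hCP (by linarith)⟩

/-- [folklore] **THE ff ENTRIES OF `P ∘ Y` RUN THROUGH MULTIPLIER MIDDLE LEGS ONLY** when `P` has no ff block:
`(P ∘ Y) y z (inl α′) (inl b) = Σ'_{y₁} Σ_m P y y₁ (inl α′)(inr m)·Y y₁ z (inr m)(inl b)`. -/
theorem comp_noFF_inl_inl {P : MKer (d + 1) (Fib d)} (hPff : ∀ (y z : Site (d + 1)) (α' a : Fin (d + 1)), P y z (Sum.inl α') (Sum.inl a) = 0)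
    (Y : MKer (d + 1) (Fib d)) (y z : Site (d + 1)) (α' b : Fin (d + 1)) :
    comp P Y y z (Sum.inl α') (Sum.inl b) = ∑' y₁ : Site (d + 1), ∑ m : Fin (d + 1), P y y₁ (Sum.inl α') (Sum.inr m) * Y y₁ z (Sum.inr m) (Sum.inl b) := by
  simp only [comp, Fintype.sum_sum_type, hPff, zero_mul, Finset.sum_const_zero, zero_add]

/-- [folklore] **A TWO-FACE WORD `(P ∘ Y) ∘ V^E_{ν,u′}` SUMMED OVER THE WILSON BOND `u′` VANISHES** when the left factor `P` (bi-localised at one point) has NO ff block, the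
middle kernel `Y` decays, and the multiplier rows of `Y` kill the background-resummed exit-face-read Wilson current `t_R` (hypothesis `hkill`, needed only for `ν ≠ β`):
level `0`, in-block root, `1 ≤ Lc`, all units, any axes.  ROUTE: `ExchangeSlotResum.hasSum_slot_word` resums `u′`; on multiplier middle legs the resummed Wilson slot is `0`
(`ExchangeFieldLegs.vertexOfK_wilson_inr_inl`), on field legs it is the nested current `t_R(b,z)` (`tsum_prod_faceHalfVertex`; for `ν = β` it is `0`,
`DressedWilsonHalfVertexAnyAxis.tsum_faceHalfVertex_snd_diag`); the ff entries of `P ∘ Y` pass through multiplier legs only, so `EEWordValue.fubini3` regroups the word as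
`Σ'_{y₁} Σ_m (Σ'_y 𝟙f·P(y,y₁)(α, inr m))·(Σ'_z Σ_b Y y₁ z (inr m)(inl b)·t_R(b,z))`, whose last factor is `hkill`. -/
theorem tsum_noFF_left_wilson_right_word_eq_zero_of (hLc : 1 ≤ Lc) (hr : r ∈ box (d + 1) Lc) (sf sm cE : ℝ) {P Y : MKer (d + 1) (Fib d)} {p : Site (d + 1)}
    {CP δP CY δY : ℝ} (hP : BiLoc P p p CP δP) (hδP : 0 < δP) (hPff : ∀ (y z : Site (d + 1)) (α' a : Fin (d + 1)), P y z (Sum.inl α') (Sum.inl a) = 0)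
    (hY : Decays Y CY δY) (hδY : 0 < δY)
    (hkill : ν ≠ β → ∀ (y₁ : Site (d + 1)) (m : Fin (d + 1)), (∑' z : Site (d + 1), ∑ b : Fin (d + 1), Y y₁ z (Sum.inr m) (Sum.inl b) *
      (∑' u' : Site (d + 1), ∑' w : Site (d + 1), (if w β % (Lc : ℤ) = (Lc : ℤ) - 1 then (1 : ℝ) else 0) *
        vertexOfK (unitK sf sm (coDressKBmAt (toSite r) Lc (KInvStep (d := d) Lc 0))) Lc (unitS sf sm (fun κ v => cE • wilsonA d κ v)) ν u' z w (Sum.inl b) (Sum.inl β))) = 0) :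
    ∑' u' : Site (d + 1), ∑' yw : Site (d + 1) × Site (d + 1), (if yw.1 α % (Lc : ℤ) = (Lc : ℤ) - 1 then (1 : ℝ) else 0) * (if yw.2 β % (Lc : ℤ) = (Lc : ℤ) - 1 then (1 : ℝ) else 0) *
        comp (comp P Y) (vertexOfK (unitK sf sm (coDressKBmAt (toSite r) Lc (KInvStep (d := d) Lc 0))) Lc (unitS sf sm (fun κ v => cE • wilsonA d κ v)) ν u')
          yw.1 yw.2 (Sum.inl α) (Sum.inl β) = 0 := by
  classical
  set X := unitK sf sm (coDressKBmAt (toSite r) Lc (KInvStep (d := d) Lc 0)) with hX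
  set VE := vertexOfK X Lc (unitS sf sm (fun κ v => cE • wilsonA d κ v)) with hVE
  obtain ⟨δ, CY', Cv, CA, hδ, hCY', hCv, hCA, hYd, hVEf, hA, hPδ⟩ := exists_decay_data_left hLc hr sf sm cE hP hδP hY hδY
  have h₁ : ∀ y : Site (d + 1), |(if y α % (Lc : ℤ) = (Lc : ℤ) - 1 then (1 : ℝ) else 0)| ≤ 1 := fun y => by split_ifs <;> simp
  have h₂ : ∀ w : Site (d + 1), |(if w β % (Lc : ℤ) = (Lc : ℤ) - 1 then (1 : ℝ) else 0)| ≤ 1 := fun w => by split_ifs <;> simp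
  -- step 1: resum the Wilson slot
  rw [(hasSum_slot_word (N := Lc) (A := comp P Y) (Q := VE ν) hδ hA (fun u' => hVEf ν u') h₁ h₂ (Sum.inl α) (Sum.inl β)).tsum_eq, Fintype.sum_sum_type]
  -- step 2: multiplier middle legs carry nothing from the Wilson slot
  have hinr : ∀ m : Fin (d + 1), (∑' yz : Site (d + 1) × Site (d + 1), (if yz.1 α % (Lc : ℤ) = (Lc : ℤ) - 1 then (1 : ℝ) else 0) * comp P Y yz.1 yz.2 (Sum.inl α) (Sum.inr m) *
      ∑' uw : Site (d + 1) × Site (d + 1), (if uw.2 β % (Lc : ℤ) = (Lc : ℤ) - 1 then (1 : ℝ) else 0) * VE ν uw.1 yz.2 uw.2 (Sum.inr m) (Sum.inl β)) = 0 := by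
    intro m
    simp only [hVE, vertexOfK_wilson_inr_inl, mul_zero, tsum_zero]
  simp only [hinr, Finset.sum_const_zero, add_zero]
  -- step 3: the degenerate axis `ν = β`: the resummed Wilson slot is already zero
  by_cases hνβ : ν = β
  · subst hνβ
    refine Finset.sum_eq_zero fun b _ => ?_
    have hz : ∀ z : Site (d + 1), (∑' uw : Site (d + 1) × Site (d + 1), (if uw.2 ν % (Lc : ℤ) = (Lc : ℤ) - 1 then (1 : ℝ) else 0) * VE ν uw.1 z uw.2 (Sum.inl b) (Sum.inl ν)) = 0 := by
      intro z
      rw [hVE, tsum_prod_faceHalfVertex hLc hr sf sm cE 0 ν ν z b, tsum_faceHalfVertex_snd_diag hLc hr sf sm cE 0 b z]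
    simp only [hz, mul_zero, tsum_zero]
  -- step 4: field middle legs: the nested current, the left factor through multiplier legs, `fubini3`
  have hT : ∀ (b : Fin (d + 1)) (z : Site (d + 1)), (∑' uw : Site (d + 1) × Site (d + 1), (if uw.2 β % (Lc : ℤ) = (Lc : ℤ) - 1 then (1 : ℝ) else 0) * VE ν uw.1 z uw.2 (Sum.inl b) (Sum.inl β)) =
      ∑' u' : Site (d + 1), ∑' w : Site (d + 1), (if w β % (Lc : ℤ) = (Lc : ℤ) - 1 then (1 : ℝ) else 0) * VE ν u' z w (Sum.inl b) (Sum.inl β) := fun b z => by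
    rw [hVE]; exact tsum_prod_faceHalfVertex hLc hr sf sm cE 0 ν β z b
  simp only [hT, comp_noFF_inl_inl hPff]
  -- bound on the resummed current (`ν ≠ β`)
  have hGp : ∀ κ l, IsPeriodic Lc ((fun κ l (x : Site (d + 1)) =>
      (if κ = ν ∧ l = β then (if x ν % (Lc : ℤ) = (Lc : ℤ) - 1 then (1 : ℝ) else 0) * (if x β % (Lc : ℤ) = (Lc : ℤ) - 1 then (1 : ℝ) else 0) else 0) -
      (if κ = β ∧ l = ν then (if x ν % (Lc : ℤ) = (Lc : ℤ) - 1 then (1 : ℝ) else 0) * (if x β % (Lc : ℤ) = (Lc : ℤ) - 1 then (1 : ℝ) else 0) else 0)) κ l) := facePlaq_periodic (d := d) Lc ν β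
  obtain ⟨M, hM, hTb⟩ : ∃ M : ℝ, 0 ≤ M ∧ ∀ (b : Fin (d + 1)) (z : Site (d + 1)),
      |∑' u' : Site (d + 1), ∑' w : Site (d + 1), (if w β % (Lc : ℤ) = (Lc : ℤ) - 1 then (1 : ℝ) else 0) * VE ν u' z w (Sum.inl b) (Sum.inl β)| ≤ M := by
    refine ⟨∑ b' : Fin (d + 1), ∑ r' ∈ box (d + 1) Lc, |((((Lc : ℝ) * (sm * sf)) * ((((Lc ^ (0 + 1) : ℕ) : ℝ)) ^ (d + 1 + 1))⁻¹) * ((sf * sm)⁻¹ * (sf⁻¹ * sf⁻¹) * cE)) * ((1 / 2 : ℝ) * curvAdj (fun κ l (x : Site (d + 1)) =>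
        (if κ = ν ∧ l = β then (if x ν % (Lc : ℤ) = (Lc : ℤ) - 1 then (1 : ℝ) else 0) * (if x β % (Lc : ℤ) = (Lc : ℤ) - 1 then (1 : ℝ) else 0) else 0) -
        (if κ = β ∧ l = ν then (if x ν % (Lc : ℤ) = (Lc : ℤ) - 1 then (1 : ℝ) else 0) * (if x β % (Lc : ℤ) = (Lc : ℤ) - 1 then (1 : ℝ) else 0) else 0)) b' (toSite r'))|,
      Finset.sum_nonneg fun _ _ => Finset.sum_nonneg fun _ _ => abs_nonneg _, fun b z => ?_⟩
    rw [hVE, (hasSum_faceHalfVertex_snd hνβ hLc hr sf sm cE 0 b z).tsum_eq]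
    have hb := bounded_of_periodic (Lc := Lc) (V := fun z => ((((Lc : ℝ) * (sm * sf)) * ((((Lc ^ (0 + 1) : ℕ) : ℝ)) ^ (d + 1 + 1))⁻¹) * ((sf * sm)⁻¹ * (sf⁻¹ * sf⁻¹) * cE)) * ((1 / 2 : ℝ) * curvAdj (fun κ l (x : Site (d + 1)) =>
        (if κ = ν ∧ l = β then (if x ν % (Lc : ℤ) = (Lc : ℤ) - 1 then (1 : ℝ) else 0) * (if x β % (Lc : ℤ) = (Lc : ℤ) - 1 then (1 : ℝ) else 0) else 0) -
        (if κ = β ∧ l = ν then (if x ν % (Lc : ℤ) = (Lc : ℤ) - 1 then (1 : ℝ) else 0) * (if x β % (Lc : ℤ) = (Lc : ℤ) - 1 then (1 : ℝ) else 0) else 0)) b z)) (fun z s => by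
      have h := smul_curvAdj_periodic (N := Lc) hGp (1 / 2 : ℝ) b z s
      show ((((Lc : ℝ) * (sm * sf)) * ((((Lc ^ (0 + 1) : ℕ) : ℝ)) ^ (d + 1 + 1))⁻¹) * ((sf * sm)⁻¹ * (sf⁻¹ * sf⁻¹) * cE)) * ((1 / 2 : ℝ) * curvAdj (fun κ l (x : Site (d + 1)) =>
        (if κ = ν ∧ l = β then (if x ν % (Lc : ℤ) = (Lc : ℤ) - 1 then (1 : ℝ) else 0) * (if x β % (Lc : ℤ) = (Lc : ℤ) - 1 then (1 : ℝ) else 0) else 0) -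
        (if κ = β ∧ l = ν then (if x ν % (Lc : ℤ) = (Lc : ℤ) - 1 then (1 : ℝ) else 0) * (if x β % (Lc : ℤ) = (Lc : ℤ) - 1 then (1 : ℝ) else 0) else 0)) b (z + (Lc : ℤ) • s)) = _
      rw [h]) z
    exact hb.trans (Finset.single_le_sum (f := fun b' => ∑ r' ∈ box (d + 1) Lc, |((((Lc : ℝ) * (sm * sf)) * ((((Lc ^ (0 + 1) : ℕ) : ℝ)) ^ (d + 1 + 1))⁻¹) * ((sf * sm)⁻¹ * (sf⁻¹ * sf⁻¹) * cE)) * ((1 / 2 : ℝ) * curvAdj (fun κ l (x : Site (d + 1)) =>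
        (if κ = ν ∧ l = β then (if x ν % (Lc : ℤ) = (Lc : ℤ) - 1 then (1 : ℝ) else 0) * (if x β % (Lc : ℤ) = (Lc : ℤ) - 1 then (1 : ℝ) else 0) else 0) -
        (if κ = β ∧ l = ν then (if x ν % (Lc : ℤ) = (Lc : ℤ) - 1 then (1 : ℝ) else 0) * (if x β % (Lc : ℤ) = (Lc : ℤ) - 1 then (1 : ℝ) else 0) else 0)) b' (toSite r'))|)
      (fun b' _ => Finset.sum_nonneg fun _ _ => abs_nonneg _) (Finset.mem_univ b))
  rw [fubini3 (ι := Fin (d + 1)) (f := fun y => (if y α % (Lc : ℤ) = (Lc : ℤ) - 1 then (1 : ℝ) else 0)) (V := fun y y₁ m => P y y₁ (Sum.inl α) (Sum.inr m))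
    (X := fun y₁ z m b => Y y₁ z (Sum.inr m) (Sum.inl b))
    (T := fun b z => ∑' u' : Site (d + 1), ∑' w : Site (d + 1), (if w β % (Lc : ℤ) = (Lc : ℤ) - 1 then (1 : ℝ) else 0) * VE ν u' z w (Sum.inl b) (Sum.inl β))
    (c := p) hδ (hP.nonneg (Sum.inl 0)) hCY' hM h₁ (fun y y₁ m => hPδ y y₁ (Sum.inl α) (Sum.inr m))
    (fun y₁ z m b => hYd y₁ z (Sum.inr m) (Sum.inl b)) hTb]
  -- step 5: the multiplier rows of `Y` kill the current
  have hk := hkill hνβ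
  simp only [hVE, hX] at hk ⊢
  simp only [hk, mul_zero, Finset.sum_const_zero, tsum_zero]


/-! ## §3 The two instances: the `S′`-vertex on the cell bond, the Wilson vertex on the lattice bond — on either side -/

variable {S' : Fin (d + 1) → Site (d + 1) → MKer (d + 1) (Fib d)} {Cs δs : ℝ}

/-- [folklore] The unit-dressed Wilson table is antisymmetric under the exchange of its two legs (`StepJetData.wilsonA_antisymm`; the units are leg-type scalars). -/
theorem unitS_wilsonA_antisymm (sf sm cE : ℝ) (κ' : Fin (d + 1)) (u x z : Site (d + 1)) (a b : Fib d) :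
    unitS sf sm (fun κ v => cE • wilsonA d κ v) κ' u z x b a = -unitS sf sm (fun κ v => cE • wilsonA d κ v) κ' u x z a b := by
  simp only [unitS_apply, Pi.smul_apply, smul_eq_mul]
  rw [StepJetData.wilsonA_antisymm]
  ring

/-- [folklore] **THE `S′ ⊗ S^E` DIRECT WORD, WILSON SLOT ON THE LATTICE BOND, VANISHES BOND BY BOND** (level `0`, in-block root, `1 ≤ Lc`, all units, any axes, any `c`;
`S′` any local stencil family with zero ff block — `cVH • vhSAt ρ`, `mfNeg (vhSAt ρ)`, …):
`Σ'_{u′} Σ'_{(y,w)} 𝟙f(y_α)𝟙f(w_β)·((vertexOfK X̃♮_0 Lc (unitS s_f s_m S′) μ c ∘ X̃♮_0) ∘ vertexOfK X̃♮_0 Lc S^E ν u′) y w (inl α)(inl β) = 0` — §2 with `Y = X̃♮_0`, whose multiplier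
rows kill the current (`DressedKernelOnFaceCurrent.tsum_dressedStep_zero_inr_mul_halfVertex_snd`, fact (d1) «Φ = 0»). -/
theorem tsum_noFF_left_wilson_right_word_eq_zero (hLc : 1 ≤ Lc) (hr : r ∈ box (d + 1) Lc) (sf sm cE : ℝ) (hS : LocStencil S' Cs δs) (hδs : 0 < δs)
    (hSff : ∀ (κ' : Fin (d + 1)) (t x z : Site (d + 1)) (α' a : Fin (d + 1)), S' κ' t x z (Sum.inl α') (Sum.inl a) = 0) (c : Site (d + 1)) :
    ∑' u' : Site (d + 1), ∑' yw : Site (d + 1) × Site (d + 1), (if yw.1 α % (Lc : ℤ) = (Lc : ℤ) - 1 then (1 : ℝ) else 0) * (if yw.2 β % (Lc : ℤ) = (Lc : ℤ) - 1 then (1 : ℝ) else 0) *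
        comp (comp (vertexOfK (unitK sf sm (coDressKBmAt (toSite r) Lc (KInvStep (d := d) Lc 0))) Lc (unitS sf sm S') μ c)
          (unitK sf sm (coDressKBmAt (toSite r) Lc (KInvStep (d := d) Lc 0))))
          (vertexOfK (unitK sf sm (coDressKBmAt (toSite r) Lc (KInvStep (d := d) Lc 0))) Lc (unitS sf sm (fun κ v => cE • wilsonA d κ v)) ν u') yw.1 yw.2 (Sum.inl α) (Sum.inl β) = 0 := by
  obtain ⟨δK, CK, hδK, hCK, hXd⟩ := decays_coDressKBmAt hLc hr (decays_KInvStep (d := d) (Lc := Lc) 0)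
  have hXu := decays_unitK (sf := sf) (sm := sm) hXd
  have hCX : 0 ≤ max |sf| |sm| * CK * max |sf| |sm| := by positivity
  have hCs : 0 ≤ Cs := (hS 0 0).nonneg (Sum.inl 0)
  set δ₁ : ℝ := min δK δs with hδ₁
  have hδ₁0 : 0 < δ₁ := lt_min hδK hδs
  have hX1 : Decays (unitK sf sm (coDressKBmAt (toSite r) Lc (KInvStep (d := d) Lc 0))) (max |sf| |sm| * CK * max |sf| |sm|) δ₁ := decays_mono hXu hCX le_rfl (min_le_left _ _)
  have hS1 : LocStencil S' Cs δ₁ := fun κ u => biLoc_mono (hS κ u) hCs (min_le_right _ _)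
  have hV' := vertexFamily_vertexOfK (N := Lc) hX1 hCX (locStencil_unitS (sf := sf) (sm := sm) hS1) hδ₁0 le_rfl
  exact tsum_noFF_left_wilson_right_word_eq_zero_of hLc hr sf sm cE (hV' μ c) (half_pos hδ₁0)
    (fun y z α' a => vertexOfK_unitS_noFF_inl_inl _ Lc sf sm hSff μ c y z α' a) hXu hδK
    (fun hνβ y₁ m => tsum_dressedStep_zero_inr_mul_halfVertex_snd hνβ hLc hr sf sm cE y₁ m)

/-- [folklore] **THE `S^E ⊗ S′` SWAP WORD, WILSON SLOT ON THE LATTICE BOND (LEFT), VANISHES BOND BY BOND**: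
`Σ'_{u′} Σ'_{(y,w)} 𝟙f(y_α)𝟙f(w_β)·((vertexOfK X̃♮_0 Lc S^E ν u′ ∘ X̃♮_0) ∘ vertexOfK X̃♮_0 Lc (unitS s_f s_m S′) μ c) y w (inl α)(inl β) = 0` — by TRANSPOSITION: the two-face pair
sum of `K` at `(α, β)` is that of `trK K` at `(β, α)` (`ExchangeSlotResum.tsum_twoFace_eq_trK`); `trK` reverses the composition (an5's `trK_comp`), the dressed kernel is
`sgnK`-symmetric (`LayerCommutatorAntisymm.trK_unitK_coDress`), the Wilson vertex is antisymmetric (`BubbleParity.trK_vertexOfK_of_antisymm`), the transposed `S′`-vertex has again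
no ff block; so the word is MINUS the §2 word with middle kernel `Y = sgnK X̃♮_0`, whose multiplier rows are minus those of `X̃♮_0` and still kill the current. -/
theorem tsum_wilson_left_noFF_right_word_eq_zero (hLc : 1 ≤ Lc) (hr : r ∈ box (d + 1) Lc) (sf sm cE : ℝ) (hS : LocStencil S' Cs δs) (hδs : 0 < δs)
    (hSff : ∀ (κ' : Fin (d + 1)) (t x z : Site (d + 1)) (α' a : Fin (d + 1)), S' κ' t x z (Sum.inl α') (Sum.inl a) = 0) (c : Site (d + 1)) :
    ∑' u' : Site (d + 1), ∑' yw : Site (d + 1) × Site (d + 1), (if yw.1 α % (Lc : ℤ) = (Lc : ℤ) - 1 then (1 : ℝ) else 0) * (if yw.2 β % (Lc : ℤ) = (Lc : ℤ) - 1 then (1 : ℝ) else 0) *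
        comp (comp (vertexOfK (unitK sf sm (coDressKBmAt (toSite r) Lc (KInvStep (d := d) Lc 0))) Lc (unitS sf sm (fun κ v => cE • wilsonA d κ v)) ν u')
          (unitK sf sm (coDressKBmAt (toSite r) Lc (KInvStep (d := d) Lc 0))))
          (vertexOfK (unitK sf sm (coDressKBmAt (toSite r) Lc (KInvStep (d := d) Lc 0))) Lc (unitS sf sm S') μ c) yw.1 yw.2 (Sum.inl α) (Sum.inl β) = 0 := by
  classical
  set X := unitK sf sm (coDressKBmAt (toSite r) Lc (KInvStep (d := d) Lc 0)) with hX
  set VE := vertexOfK X Lc (unitS sf sm (fun κ v => cE • wilsonA d κ v)) with hVE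
  set V' := vertexOfK X Lc (unitS sf sm S') μ c with hV'def
  -- decay data
  obtain ⟨δK, CK, hδK, hCK, hXd⟩ := decays_coDressKBmAt hLc hr (decays_KInvStep (d := d) (Lc := Lc) 0)
  have hXu : Decays X (max |sf| |sm| * CK * max |sf| |sm|) δK := decays_unitK (sf := sf) (sm := sm) hXd
  have hCX : 0 ≤ max |sf| |sm| * CK * max |sf| |sm| := by positivity
  have hCs : 0 ≤ Cs := (hS 0 0).nonneg (Sum.inl 0)
  set δ₁ : ℝ := min δK δs with hδ₁
  have hδ₁0 : 0 < δ₁ := lt_min hδK hδs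
  have hX1 : Decays X (max |sf| |sm| * CK * max |sf| |sm|) δ₁ := decays_mono hXu hCX le_rfl (min_le_left _ _)
  have hS1 : LocStencil S' Cs δ₁ := fun κ u => biLoc_mono (hS κ u) hCs (min_le_right _ _)
  have hV' := vertexFamily_vertexOfK (N := Lc) hX1 hCX (locStencil_unitS (sf := sf) (sm := sm) hS1) hδ₁0 le_rfl
  have hSE := locStencil_unitS (sf := sf) (sm := sm) (locStencil_smul cE (locStencil_wilsonA (d := d) hδ₁0.le))
  have hVE' := vertexFamily_vertexOfK (N := Lc) hX1 hCX hSE hδ₁0 le_rfl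
  -- the three transposition facts
  have hXt : trK X = sgnK X := trK_unitK_coDress hr 0 sf sm
  have hVEt : ∀ u' : Site (d + 1), trK (VE ν u') = -VE ν u' := fun u' =>
    trK_vertexOfK_of_antisymm (K := X) (N := Lc) (fun κ' u x z a b => unitS_wilsonA_antisymm (d := d) sf sm cE κ' u x z a b) ν u'
  -- tameness for the re-association
  have hTV' : Tame (trK V') := Loc.tame ⟨_, _, _, _, half_pos hδ₁0, biLoc_trK (hV' μ c)⟩
  have hTX : Tame (sgnK X) := Spr.tame ⟨_, _, hδK, decays_sgnK hXu⟩
  have hTVE : ∀ u' : Site (d + 1), Tame (VE ν u') := fun u' => Loc.tame ⟨_, _, _, _, half_pos hδ₁0, hVE' ν u'⟩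
  -- per bond: the word is minus the transposed word
  have e : ∀ u' : Site (d + 1), (∑' yw : Site (d + 1) × Site (d + 1), (if yw.1 α % (Lc : ℤ) = (Lc : ℤ) - 1 then (1 : ℝ) else 0) * (if yw.2 β % (Lc : ℤ) = (Lc : ℤ) - 1 then (1 : ℝ) else 0) *
        comp (comp (VE ν u') X) V' yw.1 yw.2 (Sum.inl α) (Sum.inl β)) =
      -∑' wy : Site (d + 1) × Site (d + 1), (if wy.1 β % (Lc : ℤ) = (Lc : ℤ) - 1 then (1 : ℝ) else 0) * (if wy.2 α % (Lc : ℤ) = (Lc : ℤ) - 1 then (1 : ℝ) else 0) *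
        comp (comp (trK V') (sgnK X)) (VE ν u') wy.1 wy.2 (Sum.inl β) (Sum.inl α) := by
    intro u'
    refine (tsum_twoFace_eq_trK (comp (comp (VE ν u') X) V') (fun y : Site (d + 1) => (if y α % (Lc : ℤ) = (Lc : ℤ) - 1 then (1 : ℝ) else 0))
      (fun w : Site (d + 1) => (if w β % (Lc : ℤ) = (Lc : ℤ) - 1 then (1 : ℝ) else 0)) (Sum.inl α) (Sum.inl β)).trans ?_
    rw [trK_comp, trK_comp, hXt, hVEt u', comp_neg_right, comp_neg_right, comp_assoc_tame hTV' hTX (hTVE u'), ← tsum_neg]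
    exact tsum_congr fun wy => by simp only [Pi.neg_apply]; ring
  rw [tsum_congr e, tsum_neg, neg_eq_zero]
  -- the transposed word: §2 with `P = trK V′`, `Y = sgnK X̃♮_0`, axes `(β, α)`
  refine tsum_noFF_left_wilson_right_word_eq_zero_of (α := β) (β := α) hLc hr sf sm cE (biLoc_trK (hV' μ c)) (half_pos hδ₁0)
    (fun y z α' a => by rw [trK_apply]; exact vertexOfK_unitS_noFF_inl_inl X Lc sf sm hSff μ c z y a α') (decays_sgnK hXu) hδK (fun hνα y₁ m => ?_)
  have hk := tsum_dressedStep_zero_inr_mul_halfVertex_snd (ν := ν) (β := α) hνα hLc hr sf sm cE y₁ m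
  rw [← hX, ← hVE] at hk
  have es : ∀ (z : Site (d + 1)), (∑ b : Fin (d + 1), sgnK X y₁ z (Sum.inr m) (Sum.inl b) *
      (∑' u' : Site (d + 1), ∑' w : Site (d + 1), (if w α % (Lc : ℤ) = (Lc : ℤ) - 1 then (1 : ℝ) else 0) * VE ν u' z w (Sum.inl b) (Sum.inl α))) =
      -∑ b : Fin (d + 1), X y₁ z (Sum.inr m) (Sum.inl b) *
      (∑' u' : Site (d + 1), ∑' w : Site (d + 1), (if w α % (Lc : ℤ) = (Lc : ℤ) - 1 then (1 : ℝ) else 0) * VE ν u' z w (Sum.inl b) (Sum.inl α)) := by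
    intro z
    rw [← Finset.sum_neg_distrib]
    exact Finset.sum_congr rfl fun b _ => by rw [sgnK_apply, sgnF_inr, sgnF_inl]; ring
  rw [tsum_congr es, tsum_neg, hk, neg_zero]

/-- [folklore] **IN THE ZERO MODE**: both cell-and-lattice sums `Σ_{c ∈ box N} Σ'_{u′}` — the `S′ ⊗ S^E` direct word and the `S^E ⊗ S′` swap word with the Wilson slot on the
lattice bond — are `0`. -/
theorem sum_box_noFF_wilson_words_eq_zero (hLc : 1 ≤ Lc) (hr : r ∈ box (d + 1) Lc) (sf sm cE : ℝ) (hS : LocStencil S' Cs δs) (hδs : 0 < δs)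
    (hSff : ∀ (κ' : Fin (d + 1)) (t x z : Site (d + 1)) (α' a : Fin (d + 1)), S' κ' t x z (Sum.inl α') (Sum.inl a) = 0) (N : ℕ) :
    (∑ c ∈ box (d + 1) N, ∑' u' : Site (d + 1), ∑' yw : Site (d + 1) × Site (d + 1), (if yw.1 α % (Lc : ℤ) = (Lc : ℤ) - 1 then (1 : ℝ) else 0) * (if yw.2 β % (Lc : ℤ) = (Lc : ℤ) - 1 then (1 : ℝ) else 0) *
        comp (comp (vertexOfK (unitK sf sm (coDressKBmAt (toSite r) Lc (KInvStep (d := d) Lc 0))) Lc (unitS sf sm S') μ (toSite c))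
          (unitK sf sm (coDressKBmAt (toSite r) Lc (KInvStep (d := d) Lc 0))))
          (vertexOfK (unitK sf sm (coDressKBmAt (toSite r) Lc (KInvStep (d := d) Lc 0))) Lc (unitS sf sm (fun κ v => cE • wilsonA d κ v)) ν u') yw.1 yw.2 (Sum.inl α) (Sum.inl β) = 0) ∧
    (∑ c ∈ box (d + 1) N, ∑' u' : Site (d + 1), ∑' yw : Site (d + 1) × Site (d + 1), (if yw.1 α % (Lc : ℤ) = (Lc : ℤ) - 1 then (1 : ℝ) else 0) * (if yw.2 β % (Lc : ℤ) = (Lc : ℤ) - 1 then (1 : ℝ) else 0) *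
        comp (comp (vertexOfK (unitK sf sm (coDressKBmAt (toSite r) Lc (KInvStep (d := d) Lc 0))) Lc (unitS sf sm (fun κ v => cE • wilsonA d κ v)) ν u')
          (unitK sf sm (coDressKBmAt (toSite r) Lc (KInvStep (d := d) Lc 0))))
          (vertexOfK (unitK sf sm (coDressKBmAt (toSite r) Lc (KInvStep (d := d) Lc 0))) Lc (unitS sf sm S') μ (toSite c)) yw.1 yw.2 (Sum.inl α) (Sum.inl β) = 0) :=
  ⟨Finset.sum_eq_zero fun c _ => tsum_noFF_left_wilson_right_word_eq_zero (μ := μ) (ν := ν) (α := α) (β := β) hLc hr sf sm cE hS hδs hSff (toSite c),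
    Finset.sum_eq_zero fun c _ => tsum_wilson_left_noFF_right_word_eq_zero (μ := μ) (ν := ν) (α := α) (β := β) hLc hr sf sm cE hS hδs hSff (toSite c)⟩

end Word

end Summit.QuantumFields.BalabanUV.Beta.GAN24.VHWordsZeroLattice

end
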